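import Mathlib
import HarnessLib

/-!
# Decay transfer through a Hölder split on a rare event (abstract skeleton)

Topic `Literature/Probability/Moments`; namespace `Literature.Probability.Moments`.

The measure-theoretic skeleton of the "fractional moments of the entries ⇒ first moments of the
minors" transfer used for Wick minors of random (or gauge-field dependent) Green functions, in the
spirit of the fractional-moment method (Aizenman–Molchanov; Aizenman–Warzel, *Random Operators*,
Ch. 7): a non-negative observable `X` with a `(1+ε)`-moment is split along the rare event that some
"crossing entry" `E_p` exceeds a threshold `η`; on the rare event Hölder's inequality is used, off
it an algebraic bound `X ≤ η · K · W²` with `W` of finite first moment.  Everything here is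
model-free:

* `rpow_sum_le_sum_rpow` — subadditivity of `t ↦ t^s`, `0 < s ≤ 1`, over finite sums;
* `measureReal_lt_sum_le_of_rpow_moment` — Markov: `ν{η < Σ_p E_p} ≤ η^{-s} Σ_p ∫ D_p^s` when
  `0 ≤ E_p ≤ D_p`;
* `split_bound_exp_arith` — the exponent bookkeeping turning the split bound with `η = e^{-x/2}`
  into `≤ const · e^{-γ x}`, `γ = min ((1 - s/2) ε/(1+ε)) (ε/(2(1+2ε)))`;
* `integral_le_exp_of_crossing_split` — the abstract transfer: GIVEN the split inequality on the
  probability space (hypothesis `hsplit`, a Hölder/Markov/interpolation inequality proved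
  elsewhere), the moment bounds and the algebraic implication, `∫ X ≤ K₀ e^{-γ x}` with an explicit
  `K₀`;
* `sum_comp_subtype_val_le_sum`, `twoSidedLaplace_sum_le_sq` — the purely combinatorial bound of
  a two-sided Laplace-type double sum over tuples of rows/columns of a matrix by the square of the
  sum of the norms of all its sub-minors (re-indexing along the injection `e ↦ Subtype.val ∘ e`).

No probability-space construction and no model is fixed here; the split inequality itself is an
input.
-/

noncomputable section

namespace Literature.Probability.Moments

open scoped BigOperators
open _root_.MeasureTheory _root_.Filter _root_.Finset

/-- Subadditivity of `t ↦ t ^ s` (`0 < s ≤ 1`) over finite sums of non-negative reals. [folklore] -/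
theorem rpow_sum_le_sum_rpow {ι : Type*} (T : Finset ι) (f : ι → ℝ) (hf : ∀ i ∈ T, 0 ≤ f i)
    {s : ℝ} (hs0 : 0 < s) (hs1 : s ≤ 1) :
    (∑ i ∈ T, f i) ^ s ≤ ∑ i ∈ T, f i ^ s := by
  classical
  induction T using Finset.induction_on with
  | empty => simp [Real.zero_rpow hs0.ne']
  | insert a T ha ih =>
    have hf' : ∀ i ∈ T, 0 ≤ f i := fun i hi => hf i (Finset.mem_insert_of_mem hi)
    rw [Finset.sum_insert ha, Finset.sum_insert ha]
    calc (f a + ∑ i ∈ T, f i) ^ s ≤ f a ^ s + (∑ i ∈ T, f i) ^ s :=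
          Real.rpow_add_le_add_rpow (hf a (Finset.mem_insert_self a T)) (Finset.sum_nonneg hf') hs0.le hs1
      _ ≤ f a ^ s + ∑ i ∈ T, f i ^ s := by gcongr; exact ih hf'

/-- **Markov bound for the sum of the crossing entries**: if `0 ≤ E_p ≤ D_p` with `D_p^s`
integrable (`0 < s ≤ 1`), then `ν{η < Σ_p E_p} ≤ η^{-s} Σ_p ∫ D_p^s` for `η > 0`
(`(Σ E_p)^s ≤ Σ E_p^s ≤ Σ D_p^s` and Markov's inequality). [folklore] -/
theorem measureReal_lt_sum_le_of_rpow_moment {Ω : Type*} [MeasurableSpace Ω] (ν : Measure Ω) [IsFiniteMeasure ν]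
    {P : Type*} [Fintype P] (E D : P → Ω → ℝ) {s η : ℝ} (hs0 : 0 < s) (hs1 : s ≤ 1) (hη : 0 < η)
    (hE0 : ∀ p ω, 0 ≤ E p ω) (hED : ∀ p ω, E p ω ≤ D p ω)
    (hDi : ∀ p, Integrable (fun ω => D p ω ^ s) ν) :
    ν.real {ω | η < ∑ p, E p ω} ≤ η ^ (-s) * ∑ p, ∫ ω, D p ω ^ s ∂ν := by
  set F : Ω → ℝ := fun ω => ∑ p, D p ω ^ s with hF
  have hFi : Integrable F ν := integrable_finsetSum _ fun p _ => hDi p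
  have hF0 : 0 ≤ᵐ[ν] F := Eventually.of_forall fun ω =>
    Finset.sum_nonneg fun p _ => Real.rpow_nonneg ((hE0 p ω).trans (hED p ω)) _
  have hsub : {ω | η < ∑ p, E p ω} ⊆ {ω | η ^ s ≤ F ω} := by
    intro ω hω
    simp only [Set.mem_setOf_eq] at hω ⊢
    calc η ^ s ≤ (∑ p, E p ω) ^ s := Real.rpow_le_rpow hη.le hω.le hs0.le
      _ ≤ ∑ p, E p ω ^ s := rpow_sum_le_sum_rpow _ _ (fun p _ => hE0 p ω) hs0 hs1
      _ ≤ F ω := Finset.sum_le_sum fun p _ => Real.rpow_le_rpow (hE0 p ω) (hED p ω) hs0.le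
  have hmarkov := mul_meas_ge_le_integral_of_nonneg hF0 hFi (η ^ s)
  have hηs : 0 < η ^ s := Real.rpow_pos_of_pos hη s
  calc ν.real {ω | η < ∑ p, E p ω} ≤ ν.real {ω | η ^ s ≤ F ω} := measureReal_mono hsub
    _ ≤ η ^ (-s) * ∫ ω, F ω ∂ν := by
        rw [Real.rpow_neg hη.le, le_inv_mul_iff₀ hηs]
        exact hmarkov
    _ = η ^ (-s) * ∑ p, ∫ ω, D p ω ^ s ∂ν := by rw [integral_finsetSum _ fun p _ => hDi p]

/-- **Exponent bookkeeping of the split.** With `η = e^{-x/2}`, `0 ≤ A ≤ C_A`,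
`0 ≤ P ≤ N · η^{-s} e^{-x}`, `0 ≤ B ≤ C_B`, the split bound
`I ≤ A^{1/(1+ε)} P^{ε/(1+ε)} + η^{ε/(1+2ε)} B^{2ε/(1+2ε)} A^{1/(1+2ε)}` gives
`I ≤ (C_A^{1/(1+ε)} N^{ε/(1+ε)} + C_B^{2ε/(1+2ε)} C_A^{1/(1+2ε)}) e^{-γ x}`,
`γ = min ((1 - s/2) ε/(1+ε)) (ε/(2(1+2ε)))`. [folklore] -/
theorem split_bound_exp_arith {ε s x A P B I CA CB N : ℝ} (hε : 0 < ε) (hx : 0 ≤ x) (hN : 0 ≤ N)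
    (hA0 : 0 ≤ A) (hA : A ≤ CA) (hP0 : 0 ≤ P)
    (hP : P ≤ N * Real.exp (-(x / 2)) ^ (-s) * Real.exp (-x)) (hB0 : 0 ≤ B) (hB : B ≤ CB)
    (hI : I ≤ A ^ (1 / (1 + ε)) * P ^ (ε / (1 + ε)) +
      Real.exp (-(x / 2)) ^ (ε / (1 + 2 * ε)) * B ^ (2 * ε / (1 + 2 * ε)) * A ^ (1 / (1 + 2 * ε))) :
    I ≤ (CA ^ (1 / (1 + ε)) * N ^ (ε / (1 + ε)) + CB ^ (2 * ε / (1 + 2 * ε)) * CA ^ (1 / (1 + 2 * ε))) *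
      Real.exp (-(min ((1 - s / 2) * ε / (1 + ε)) (ε / (2 * (1 + 2 * ε))) * x)) := by
  set γ := min ((1 - s / 2) * ε / (1 + ε)) (ε / (2 * (1 + 2 * ε))) with hγ
  have hε1 : 0 < 1 + ε := by linarith
  have hε2 : 0 < 1 + 2 * ε := by linarith
  have hP' : P ≤ N * Real.exp (-((1 - s / 2) * x)) := by
    have : Real.exp (-(x / 2)) ^ (-s) * Real.exp (-x) = Real.exp (-((1 - s / 2) * x)) := by
      rw [← Real.exp_mul, ← Real.exp_add]; ring_nf
    calc P ≤ N * Real.exp (-(x / 2)) ^ (-s) * Real.exp (-x) := hP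
      _ = N * Real.exp (-((1 - s / 2) * x)) := by rw [mul_assoc, this]
  have hCA : 0 ≤ CA := hA0.trans hA
  have hCB : 0 ≤ CB := hB0.trans hB
  have ha0 : 0 ≤ 1 / (1 + ε) := by positivity
  have hb0 : 0 ≤ ε / (1 + ε) := by positivity
  have hc0 : 0 ≤ 2 * ε / (1 + 2 * ε) := by positivity
  have hd0 : 0 ≤ 1 / (1 + 2 * ε) := by positivity
  -- first term
  have h1 : A ^ (1 / (1 + ε)) * P ^ (ε / (1 + ε)) ≤
      CA ^ (1 / (1 + ε)) * N ^ (ε / (1 + ε)) * Real.exp (-(γ * x)) := by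
    have e1 : (N * Real.exp (-((1 - s / 2) * x))) ^ (ε / (1 + ε)) =
        N ^ (ε / (1 + ε)) * Real.exp (-((1 - s / 2) * x) * (ε / (1 + ε))) := by
      rw [Real.mul_rpow hN (Real.exp_pos _).le, Real.exp_mul]
    have e2 : Real.exp (-((1 - s / 2) * x) * (ε / (1 + ε))) ≤ Real.exp (-(γ * x)) := by
      rw [Real.exp_le_exp]
      have hγ1 : γ ≤ (1 - s / 2) * ε / (1 + ε) := min_le_left _ _
      have : γ * x ≤ (1 - s / 2) * ε / (1 + ε) * x := mul_le_mul_of_nonneg_right hγ1 hx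
      have e3 : -((1 - s / 2) * x) * (ε / (1 + ε)) = -((1 - s / 2) * ε / (1 + ε) * x) := by ring
      rw [e3]; linarith
    calc A ^ (1 / (1 + ε)) * P ^ (ε / (1 + ε))
        ≤ CA ^ (1 / (1 + ε)) * (N * Real.exp (-((1 - s / 2) * x))) ^ (ε / (1 + ε)) :=
          mul_le_mul (Real.rpow_le_rpow hA0 hA ha0) (Real.rpow_le_rpow hP0 hP' hb0)
            (Real.rpow_nonneg hP0 _) (Real.rpow_nonneg hCA _)
      _ = CA ^ (1 / (1 + ε)) * N ^ (ε / (1 + ε)) * Real.exp (-((1 - s / 2) * x) * (ε / (1 + ε))) := by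
          rw [e1, mul_assoc]
      _ ≤ CA ^ (1 / (1 + ε)) * N ^ (ε / (1 + ε)) * Real.exp (-(γ * x)) :=
          mul_le_mul_of_nonneg_left e2 (mul_nonneg (Real.rpow_nonneg hCA _) (Real.rpow_nonneg hN _))
  -- second term
  have h2 : Real.exp (-(x / 2)) ^ (ε / (1 + 2 * ε)) * B ^ (2 * ε / (1 + 2 * ε)) * A ^ (1 / (1 + 2 * ε)) ≤
      Real.exp (-(γ * x)) * CB ^ (2 * ε / (1 + 2 * ε)) * CA ^ (1 / (1 + 2 * ε)) := by
    have e1 : Real.exp (-(x / 2)) ^ (ε / (1 + 2 * ε)) ≤ Real.exp (-(γ * x)) := by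
      rw [← Real.exp_mul, Real.exp_le_exp]
      have hγ2 : γ ≤ ε / (2 * (1 + 2 * ε)) := min_le_right _ _
      have : γ * x ≤ ε / (2 * (1 + 2 * ε)) * x := mul_le_mul_of_nonneg_right hγ2 hx
      have e3 : -(x / 2) * (ε / (1 + 2 * ε)) = -(ε / (2 * (1 + 2 * ε)) * x) := by
        field_simp
      rw [e3]; linarith
    exact mul_le_mul (mul_le_mul e1 (Real.rpow_le_rpow hB0 hB hc0) (Real.rpow_nonneg hB0 _)
      (Real.exp_pos _).le) (Real.rpow_le_rpow hA0 hA hd0) (Real.rpow_nonneg hA0 _)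
      (mul_nonneg (Real.exp_pos _).le (Real.rpow_nonneg hCB _))
  calc I ≤ _ := hI
    _ ≤ CA ^ (1 / (1 + ε)) * N ^ (ε / (1 + ε)) * Real.exp (-(γ * x)) +
          Real.exp (-(γ * x)) * CB ^ (2 * ε / (1 + 2 * ε)) * CA ^ (1 / (1 + 2 * ε)) := add_le_add h1 h2
    _ = _ := by ring

/-- **The abstract decay transfer.** On a probability space carrying the split inequality
`hsplit` (Hölder on a rare event plus interpolation off it), let `X ≥ 0` have a `(1+ε)`-moment
`≤ C_A`, `W ≥ 0` a first moment `≤ C_W`, and let finitely many non-negative measurable "crossing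
entries" `E_p ≤ D_p` have dominators with `∫ D_p^s ≤ C_T e^{-x}` (`0 < s < 1`, `x ≥ 0`).  If
`X ≤ η · K · W²` whenever all `E_p ≤ η` (`0 < η ≤ 1`), then
`∫ X ≤ (C_A^{1/(1+ε)} (N C_T)^{ε/(1+ε)} + (√K C_W)^{2ε/(1+2ε)} C_A^{1/(1+2ε)}) e^{-γ x}` with
`γ = min ((1 - s/2) ε/(1+ε)) (ε/(2(1+2ε)))`, `N ≥ #P` (apply the split with `Y = K W²`,
`G = Σ_p E_p`, `η = e^{-x/2}`, and Markov for `G`). [folklore] -/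
theorem integral_le_exp_of_crossing_split {Ω : Type} [MeasurableSpace Ω] (ν : Measure Ω)
    [IsProbabilityMeasure ν]
    (hsplit : ∀ (X Y G : Ω → ℝ) (ε η : ℝ) (q : ℕ),
        0 < ε → 0 < η → η ≤ 1 → (∀ ω, 0 ≤ X ω) → (∀ ω, 0 ≤ Y ω) → Measurable X → Measurable Y → Measurable G →
        Integrable (fun ω => X ω ^ (1 + ε)) ν → Integrable (fun ω => Real.sqrt (Y ω)) ν →
        (∀ ω, G ω ≤ η → X ω ≤ η ^ q * Y ω) →
          ∫ ω, X ω ∂ν ≤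
            (∫ ω, X ω ^ (1 + ε) ∂ν) ^ (1 / (1 + ε)) * (ν {ω | η < G ω}).toReal ^ (ε / (1 + ε)) +
              η ^ ((q : ℝ) * ε / (1 + 2 * ε)) * (∫ ω, Real.sqrt (Y ω) ∂ν) ^ (2 * ε / (1 + 2 * ε)) *
                (∫ ω, X ω ^ (1 + ε) ∂ν) ^ (1 / (1 + 2 * ε)))
    {P : Type*} [Fintype P] (E D : P → Ω → ℝ) (X W : Ω → ℝ) {ε s K CA CW CT N x : ℝ}
    (hε : 0 < ε) (hs0 : 0 < s) (hs1 : s < 1) (hK : 0 ≤ K) (hx : 0 ≤ x) (hCT : 0 ≤ CT)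
    (hN : (Fintype.card P : ℝ) ≤ N)
    (hX0 : ∀ ω, 0 ≤ X ω) (hXm : Measurable X) (hXi : Integrable (fun ω => X ω ^ (1 + ε)) ν)
    (hXA : ∫ ω, X ω ^ (1 + ε) ∂ν ≤ CA)
    (hW0 : ∀ ω, 0 ≤ W ω) (hWm : Measurable W) (hWi : Integrable W ν) (hWB : ∫ ω, W ω ∂ν ≤ CW)
    (hE0 : ∀ p ω, 0 ≤ E p ω) (hEm : ∀ p, Measurable (E p)) (hED : ∀ p ω, E p ω ≤ D p ω)
    (hDi : ∀ p, Integrable (fun ω => D p ω ^ s) ν)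
    (hDT : ∀ p, ∫ ω, D p ω ^ s ∂ν ≤ CT * Real.exp (-x))
    (halg : ∀ ω η, 0 < η → η ≤ 1 → (∀ p, E p ω ≤ η) → X ω ≤ η * (K * W ω ^ 2)) :
    ∫ ω, X ω ∂ν ≤
      (CA ^ (1 / (1 + ε)) * (N * CT) ^ (ε / (1 + ε)) +
          (Real.sqrt K * CW) ^ (2 * ε / (1 + 2 * ε)) * CA ^ (1 / (1 + 2 * ε))) *
        Real.exp (-(min ((1 - s / 2) * ε / (1 + ε)) (ε / (2 * (1 + 2 * ε))) * x)) := by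
  set η : ℝ := Real.exp (-(x / 2)) with hηdef
  have hη0 : 0 < η := Real.exp_pos _
  have hη1 : η ≤ 1 := Real.exp_le_one_iff.2 (by linarith)
  have hY0 : ∀ ω, 0 ≤ K * W ω ^ 2 := fun ω => by positivity
  have hYm : Measurable fun ω => K * W ω ^ 2 := (hWm.pow_const 2).const_mul K
  have hGm : Measurable fun ω => ∑ p, E p ω := Finset.measurable_sum _ fun p _ => hEm p
  have hsqrt : ∀ ω, Real.sqrt (K * W ω ^ 2) = Real.sqrt K * W ω := fun ω => by
    rw [Real.sqrt_mul hK, Real.sqrt_sq (hW0 ω)]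
  have hsYi : Integrable (fun ω => Real.sqrt (K * W ω ^ 2)) ν := by
    simp_rw [hsqrt]; exact hWi.const_mul _
  have himp : ∀ ω, (∑ p, E p ω) ≤ η → X ω ≤ η ^ 1 * (K * W ω ^ 2) := fun ω hω => by
    rw [pow_one]
    exact halg ω η hη0 hη1 fun p =>
      (Finset.single_le_sum (f := fun q => E q ω) (fun q _ => hE0 q ω) (Finset.mem_univ p)).trans hω
  have hI := hsplit X (fun ω => K * W ω ^ 2) (fun ω => ∑ p, E p ω) ε η 1 hε hη0 hη1 hX0 hY0 hXm hYm
    hGm hXi hsYi himp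
  simp only [Nat.cast_one, one_mul] at hI
  -- the rare event
  have hPtail : (ν {ω | η < ∑ p, E p ω}).toReal ≤ N * CT * η ^ (-s) * Real.exp (-x) := by
    rw [← measureReal_def]
    calc ν.real {ω | η < ∑ p, E p ω} ≤ η ^ (-s) * ∑ p, ∫ ω, D p ω ^ s ∂ν :=
          measureReal_lt_sum_le_of_rpow_moment ν E D hs0 hs1.le hη0 hE0 hED hDi
      _ ≤ η ^ (-s) * ∑ _p : P, CT * Real.exp (-x) :=
          mul_le_mul_of_nonneg_left (Finset.sum_le_sum fun p _ => hDT p) (Real.rpow_nonneg hη0.le _)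
      _ = η ^ (-s) * (Fintype.card P * (CT * Real.exp (-x))) := by
          rw [Finset.sum_const, nsmul_eq_mul, Finset.card_univ]
      _ ≤ η ^ (-s) * (N * (CT * Real.exp (-x))) :=
          mul_le_mul_of_nonneg_left (mul_le_mul_of_nonneg_right hN (by positivity))
            (Real.rpow_nonneg hη0.le _)
      _ = N * CT * η ^ (-s) * Real.exp (-x) := by ring
  -- the dominator integral
  have hB : ∫ ω, Real.sqrt (K * W ω ^ 2) ∂ν ≤ Real.sqrt K * CW := by
    simp_rw [hsqrt]
    rw [integral_const_mul]
    exact mul_le_mul_of_nonneg_left hWB (Real.sqrt_nonneg K)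
  have hNCT : 0 ≤ N * CT := mul_nonneg ((Nat.cast_nonneg _).trans hN) hCT
  have hP' : (ν {ω | η < ∑ p, E p ω}).toReal ≤ N * CT * Real.exp (-(x / 2)) ^ (-s) * Real.exp (-x) := hPtail
  exact split_bound_exp_arith hε hx hNCT (integral_nonneg fun ω => Real.rpow_nonneg (hX0 ω) _) hXA
    ENNReal.toReal_nonneg hP' (integral_nonneg fun ω => Real.sqrt_nonneg _) hB hI

/-- Re-indexing bound: a non-negative function summed over maps into a subtype is at most its sum
over all maps (the map `e ↦ Subtype.val ∘ e` is injective). [folklore] -/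
theorem sum_comp_subtype_val_le_sum {i r : ℕ} (pr : Fin r → Prop) [DecidablePred pr]
    (F : (Fin i → Fin r) → ℝ) (hF : ∀ g, 0 ≤ F g) :
    ∑ e : Fin i → {a // pr a}, F (fun t => (e t).1) ≤ ∑ g : Fin i → Fin r, F g := by
  let emb : (Fin i → {a // pr a}) ↪ (Fin i → Fin r) :=
    ⟨fun e t => (e t).1, fun e₁ e₂ h => funext fun t => Subtype.ext (congrFun h t)⟩
  calc ∑ e : Fin i → {a // pr a}, F (fun t => (e t).1) = ∑ g ∈ Finset.univ.map emb, F g := by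
        rw [Finset.sum_map]; rfl
    _ ≤ ∑ g : Fin i → Fin r, F g := Finset.sum_le_univ_sum_of_nonneg hF

/-- **The two-sided Laplace sum is at most the square of the sum of all sub-minors.** For any
square matrix `M` and side patterns `sr, sc`, the sum over `i, j` and over `i`-tuples of
`true`-rows/columns and `j`-tuples of `false`-rows/columns of `|det M[e₁,e₂]| · |det M[e₃,e₄]|` is
bounded by `(Σ_{i ≤ r} Σ_{g,h : Fin i → Fin r} |det M[g,h]|)²`. [folklore] -/
theorem twoSidedLaplace_sum_le_sq {r : ℕ} (M : Matrix (Fin r) (Fin r) ℂ) (sr sc : Fin r → Bool) :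
    (∑ i : Fin (r + 1), ∑ j : Fin (r + 1),
      ∑ e₁ : Fin (i : ℕ) → {a // sr a = true}, ∑ e₂ : Fin (i : ℕ) → {b // sc b = true},
        ∑ e₃ : Fin (j : ℕ) → {a // sr a = false}, ∑ e₄ : Fin (j : ℕ) → {b // sc b = false},
          ‖(M.submatrix (fun t => (e₁ t).1) (fun t => (e₂ t).1)).det‖ *
            ‖(M.submatrix (fun t => (e₃ t).1) (fun t => (e₄ t).1)).det‖) ≤
      (∑ τ : (i : Fin (r + 1)) × ((Fin (i : ℕ) → Fin r) × (Fin (i : ℕ) → Fin r)),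
        ‖(M.submatrix τ.2.1 τ.2.2).det‖) ^ 2 := by
  set w : Fin (r + 1) → ℝ := fun i =>
    ∑ g : Fin (i : ℕ) → Fin r, ∑ h : Fin (i : ℕ) → Fin r, ‖(M.submatrix g h).det‖ with hw
  have hflat : (∑ τ : (i : Fin (r + 1)) × ((Fin (i : ℕ) → Fin r) × (Fin (i : ℕ) → Fin r)),
      ‖(M.submatrix τ.2.1 τ.2.2).det‖) = ∑ i, w i := by
    rw [Fintype.sum_sigma]
    refine Finset.sum_congr rfl fun i _ => ?_
    rw [hw, Fintype.sum_prod_type]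
  have key : ∀ (i : Fin (r + 1)) (pr pc : Fin r → Prop) [DecidablePred pr] [DecidablePred pc],
      ∑ e₁ : Fin (i : ℕ) → {a // pr a}, ∑ e₂ : Fin (i : ℕ) → {b // pc b},
        ‖(M.submatrix (fun t => (e₁ t).1) (fun t => (e₂ t).1)).det‖ ≤ w i := by
    intro i pr pc _ _
    calc ∑ e₁ : Fin (i : ℕ) → {a // pr a}, ∑ e₂ : Fin (i : ℕ) → {b // pc b},
          ‖(M.submatrix (fun t => (e₁ t).1) (fun t => (e₂ t).1)).det‖
        ≤ ∑ e₁ : Fin (i : ℕ) → {a // pr a}, ∑ h : Fin (i : ℕ) → Fin r,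
            ‖(M.submatrix (fun t => (e₁ t).1) h).det‖ :=
          Finset.sum_le_sum fun e₁ _ => sum_comp_subtype_val_le_sum pc
            (fun h => ‖(M.submatrix (fun t => (e₁ t).1) h).det‖) fun _ => norm_nonneg _
      _ ≤ w i := sum_comp_subtype_val_le_sum pr (fun g => ∑ h : Fin (i : ℕ) → Fin r, ‖(M.submatrix g h).det‖)
            fun _ => Finset.sum_nonneg fun _ _ => norm_nonneg _
  have hw0 : ∀ i, 0 ≤ w i := fun i =>
    Finset.sum_nonneg fun _ _ => Finset.sum_nonneg fun _ _ => norm_nonneg _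
  have hA : ∑ i : Fin (r + 1), ∑ e₁ : Fin (i : ℕ) → {a // sr a = true},
      ∑ e₂ : Fin (i : ℕ) → {b // sc b = true},
        ‖(M.submatrix (fun t => (e₁ t).1) (fun t => (e₂ t).1)).det‖ ≤ ∑ i, w i :=
    Finset.sum_le_sum fun i _ => key i _ _
  have hB : ∑ j : Fin (r + 1), ∑ e₃ : Fin (j : ℕ) → {a // sr a = false},
      ∑ e₄ : Fin (j : ℕ) → {b // sc b = false},
        ‖(M.submatrix (fun t => (e₃ t).1) (fun t => (e₄ t).1)).det‖ ≤ ∑ i, w i :=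
    Finset.sum_le_sum fun j _ => key j _ _
  rw [hflat]
  calc _ = (∑ i : Fin (r + 1), ∑ e₁ : Fin (i : ℕ) → {a // sr a = true},
            ∑ e₂ : Fin (i : ℕ) → {b // sc b = true},
              ‖(M.submatrix (fun t => (e₁ t).1) (fun t => (e₂ t).1)).det‖) *
          (∑ j : Fin (r + 1), ∑ e₃ : Fin (j : ℕ) → {a // sr a = false},
            ∑ e₄ : Fin (j : ℕ) → {b // sc b = false},
              ‖(M.submatrix (fun t => (e₃ t).1) (fun t => (e₄ t).1)).det‖) := by
        simp only [← Finset.mul_sum, ← Finset.sum_mul]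
    _ ≤ (∑ i, w i) * (∑ i, w i) :=
        mul_le_mul hA hB (Finset.sum_nonneg fun _ _ => Finset.sum_nonneg fun _ _ =>
          Finset.sum_nonneg fun _ _ => norm_nonneg _) (Finset.sum_nonneg fun i _ => hw0 i)
    _ = (∑ i, w i) ^ 2 := (sq _).symm

end Literature.Probability.Moments

end
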